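import Summits.RiemannHypothesis.RiemannHypothesis.Theses.OddSector
import Summits.RiemannHypothesis.RiemannHypothesis.Theorems.RuelleBandExactFirstBandStubOddSectorCriterion
import Literature.NumberTheory.LFunctions.WeilGroundEnergyProofs
import Literature.NumberTheory.LFunctions.WeilMellinBounds
import Literature.NumberTheory.LFunctions.ZetaRealAxis
import Literature.NumberTheory.LFunctions.GeneralizedRH
import HarnessLib

/-!
# RiemannHypothesis / OddSector — crux `OddNegativityOffLine` (stmt-RiemannHypothesis-17780)

Route `RiemannHypothesis/OddSector`, crux item `stmt-RiemannHypothesis-17780`, line `Sketch`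
(idea `contrapose-landed-odd-criterion`):

  `OddNegativityOffLine := ¬ RH → ∃ η > 0, ∃ A, ∀ a ≥ A, ∃ h` smooth of compact support, supported
  in `[-a, a]`, odd, `‖h‖₂ = 1`, with `Re Q(h) ≤ -η`,

where `Q` is Weil's quadratic functional `W(h ⋆ h̃)` written out over Mathlib primitives (rev 1
of the route; definitionally `Literature.NumberTheory.LFunctions.weilQuadratic`, and the test
class is definitionally `IsWeilTest` — the first tactic of `oddNegativityOffLine_proof` is the
corresponding `show`).

This is Yoshida's odd criterion (H. Yoshida, *On Hermitian forms attached to zeta functions*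
(1992), Prop. 1(1), hard half) in contrapositive, normalised, window-uniform form. The hard half
for `ζ` is already a theorem of the tree, Summit-side:
`RuelleBandExactFirstBand.stub_oddSectorCriterion` (Weil positivity on ODD REAL-valued tests ⟹
every zero of `ζ` in the open strip lies on the critical line or on the real axis; proved by the
one-sided Landau engine of that line). We contrapose it: a strip zero on the real axis is excluded
by `riemannZeta_ofReal_ne_zero_of_pos_of_lt_one`, and strip-RH is Mathlib's `RiemannHypothesis`
by `riemannHypothesis_iff_strip_holds`; this gives an odd (real-valued) test `g` with
`Re Q(g) < 0` (`oddNegativityOffLine_exists_odd_real_neg`). Then `g ≠ 0` (as `Q(0) = 0`), so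
`c := ‖g‖₂⁻¹` normalises it (`weilQuadratic_const_mul`: `Q(c g) = c² Q(g) < 0`), `η := -Re Q(c g)`,
and `A :=` a support radius of `g`: the same witness serves every window `a ≥ A` by support
inclusion.

References: H. Yoshida (1992) [Yoshida1992HermitianForms, Prop. 1(1)]; E. Bombieri, *Remarks on
Weil's quadratic functional in the theory of prime numbers I* (2000) [Bombieri2000Weil, §5].
-/

noncomputable section

-- D-0017: single-problem summit ⇒ namespace `Summit.RiemannHypothesis.RiemannHypothesis.…` by design.
set_option linter.dupNamespace false

namespace Summit.RiemannHypothesis.RiemannHypothesis.Theorems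

open MeasureTheory Set
open Literature.NumberTheory.LFunctions
open Summit.RiemannHypothesis.RiemannHypothesis.Theorems.RuelleBandExactFirstBand

/-- **First lemma of the line.** If the Riemann hypothesis fails, some smooth compactly supported
ODD REAL-valued `g` has `Re W(g ⋆ g̃) < 0`: contrapose the landed odd-sector criterion
`stub_oddSectorCriterion`; a strip zero on the real axis is excluded by
`riemannZeta_ofReal_ne_zero_of_pos_of_lt_one`, and strip-RH is `RiemannHypothesis` by
`riemannHypothesis_iff_strip_holds`. [cite: Yoshida1992HermitianForms, Prop. 1(1)] -/
theorem oddNegativityOffLine_exists_odd_real_neg (hRH : ¬ RiemannHypothesis) :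
    ∃ g : ℝ → ℂ, IsWeilTest g ∧ (∀ t : ℝ, g (-t) = -g t) ∧ (∀ t : ℝ, (g t).im = 0) ∧
      (weilQuadratic g).re < 0 := by
  by_contra hne
  push Not at hne
  apply hRH
  have hstrip := stub_oddSectorCriterion (fun g hg hodd hreal => hne g hg hodd hreal)
  refine riemannHypothesis_iff_strip_holds.2 fun s hs h0 h1 => ?_
  rcases hstrip s hs h0 h1 with h | him
  · exact h
  · exfalso
    have e : ((s.re : ℝ) : ℂ) = s := Complex.ext (by simp) (by simp [him])
    have hs' : riemannZeta ((s.re : ℝ) : ℂ) = 0 := by rw [e]; exact hs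
    exact riemannZeta_ofReal_ne_zero_of_pos_of_lt_one s.re h0 h1 hs'

/-- **Item `stmt-RiemannHypothesis-17780` (`OddSector.OddNegativityOffLine`)** — Yoshida's odd
criterion, hard half, in contrapositive, normalised and window-uniform form: if RH fails there are
`η > 0` and `A` such that every window `a ≥ A` carries an `L²`-normalised smooth odd test `h`
supported in `[-a, a]` with `Re Q(h) ≤ -η`. Proof: `show` the Literature form (rev-1 defeq), take
the odd witness `g` of `oddNegativityOffLine_exists_odd_real_neg` (`g ≠ 0` since `Q(0) = 0`),
normalise by `c = ‖g‖₂⁻¹` (`Q(c g) = c² Q(g) < 0`, `weilQuadratic_const_mul`), put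
`η := -Re Q(c g)` and let `A` be a support radius of `g`; larger windows contain the support.
[cite: Yoshida1992HermitianForms, Prop. 1(1)] -/
theorem oddNegativityOffLine_proof :
    Summit.RiemannHypothesis.RiemannHypothesis.Theses.OddSector.OddNegativityOffLine := by
  show ¬ RiemannHypothesis → ∃ η : ℝ, 0 < η ∧ ∃ A : ℝ, ∀ a : ℝ, A ≤ a → ∃ h : ℝ → ℂ,
    IsWeilTest h ∧ tsupport h ⊆ Set.Icc (-a) a ∧ (∀ t, h (-t) = -h t) ∧
    ∫ t, ‖h t‖ ^ 2 = (1 : ℝ) ∧ (weilQuadratic h).re ≤ -η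
  intro hRH
  obtain ⟨g, hg, hodd, -, hneg⟩ := oddNegativityOffLine_exists_odd_real_neg hRH
  have hN2nn : 0 ≤ ∫ t : ℝ, ‖g t‖ ^ 2 := integral_nonneg fun _ => by positivity
  have hpos : 0 < ∫ t : ℝ, ‖g t‖ ^ 2 := by
    rcases hN2nn.eq_or_lt with hz | hpos
    · exfalso
      have hg0 : g = 0 := hg.eq_zero_of_integral_norm_sq_eq_zero hz.symm
      subst hg0
      rw [weilQuadratic_zero, Complex.zero_re] at hneg
      exact lt_irrefl _ hneg
    · exact hpos
  set N2 : ℝ := ∫ t : ℝ, ‖g t‖ ^ 2 with hN2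
  set c : ℝ := (Real.sqrt N2)⁻¹ with hc
  have hcpos : 0 < c := inv_pos.2 (Real.sqrt_pos.2 hpos)
  -- the normalised witness
  have hht : IsWeilTest fun t => (c : ℂ) * g t := hg.const_mul c
  have hnorm : ∫ t : ℝ, ‖(c : ℂ) * g t‖ ^ 2 = 1 := by
    simp only [norm_mul, mul_pow, Complex.norm_real, Real.norm_of_nonneg hcpos.le]
    rw [integral_const_mul, hc, inv_pow, Real.sq_sqrt hN2nn, inv_mul_cancel₀ hpos.ne']
  have hQ : (weilQuadratic fun t => (c : ℂ) * g t).re = c * c * (weilQuadratic g).re := by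
    rw [weilQuadratic_const_mul, Complex.normSq_ofReal, Complex.re_ofReal_mul]
  have hQneg : (weilQuadratic fun t => (c : ℂ) * g t).re < 0 := by
    rw [hQ]; exact mul_neg_of_pos_of_neg (mul_pos hcpos hcpos) hneg
  -- a support radius
  obtain ⟨r, hr⟩ := hg.2.isCompact.isBounded.subset_closedBall (0 : ℝ)
  refine ⟨-(weilQuadratic fun t => (c : ℂ) * g t).re, by linarith, r, fun a ha => ?_⟩
  refine ⟨fun t => (c : ℂ) * g t, hht, ?_, fun t => ?_, hnorm, by linarith⟩
  · refine tsupport_mul_subset_right.trans (hr.trans ?_)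
    rw [Real.closedBall_eq_Icc, zero_sub, zero_add]
    exact Set.Icc_subset_Icc (neg_le_neg ha) ha
  · show (c : ℂ) * g (-t) = -((c : ℂ) * g t)
    rw [hodd, mul_neg]

end Summit.RiemannHypothesis.RiemannHypothesis.Theorems

end
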